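import Summits.CriticalPhenomena.PercolationContinuityZ3.Theorems.SahiBoxTP2HilbertAffiliation

/-!
# Affiliated ⟹ box-TP₂: the full equivalence box-TP₂ ⟺ set-TP₂ ⟺ affiliated for arbitrary laws on `Q_d` and on the Hilbert cube

Support file of the Sahi cell (`prim-sahi`, typer seat, generation 12; `--supports stmt-CriticalPhenomena-4575`).
Converse half of `SahiBoxTP2Affiliation.lean` / `SahiBoxTP2HilbertAffiliation.lean`.

Milgrom–Weber's four-box device (tree: `mIsAffiliated.icc_mul_icc_le_of_separated`, literature seat) gives the box-TP₂
inequality of an AFFILIATED measure for CROSSWISE SEPARATED pairs of boxes only.  That is enough: two cells of the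
`(m+1)^d` grid are either comparable (then the cell-lattice inequality is an equality) or their inner approximating
closed boxes (generation 11, `cubeCell_preimage_singleton_eq_iUnion`) are crosswise separated
(`not_cellLoCorner_le_cellHiCorner`); hence an affiliated probability measure is cell-FKG on every grid
(`affiliated_isFKGMeasure_cubeCellWeight`), hence box-TP₂ (generation 11, `isBoxTP2_of_isFKGMeasure_cubeCellWeight`):

* **`isBoxTP2_iff_mIsAffiliated`**, **`mIsSetTP2_iff_mIsAffiliated`** — for EVERY probability measure on `Q_d`:
  box-TP₂ ⟺ set-TP₂ ⟺ affiliated (Müller–Stoyan's Theorem 3.10.14 in full, with the density-free (i) = box-TP₂).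
* The Hilbert cube: marginals of an affiliated law are affiliated (`affiliated_map_finRestrict`), so
  **`isBoxTP2_iff_mIsAffiliated_hilbert`**, **`mIsSetTP2_iff_mIsAffiliated_hilbert`** for every probability measure on
  `ℕ → [0,1]`.

No sorries, no new axioms.
-/

noncomputable section

namespace Summit.CriticalPhenomena.PercolationContinuityZ3.Theorems.SahiBoxTP2

open MeasureTheory ProbabilityTheory Set Filter Topology Function Literature.Combinatorics.Sahi2008
open Literature.Combinatorics.Sahi2008.LebesgueSquare (gridPt cellIdx)
open Literature.Combinatorics.Sahi2008.LebesgueCube (cubeCell measurable_cubeCell cubeCell_mono)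
open Summit.CriticalPhenomena.PercolationContinuityZ3.Theorems.SahiCubeDensity (cubeCellWeight)
open Literature.Probability.LatticeModels.Affiliation (mIsAffiliated mIsSetTP2)
open scoped ENNReal unitInterval

variable {d m : ℕ}

/-! ### Inner boxes of incomparable cells are crosswise separated -/

/-- If cell `c'` is strictly below cell `c` in some coordinate, the lower corner of `c` is NOT below the (inner) upper
corner of `c'`. [folklore] -/
theorem not_cellLoCorner_le_cellHiCorner {c c' : Fin d → Fin (m + 1)} {j : Fin d} (hj : c' j < c j) (k : ℕ) :
    ¬ cellLoCorner m c ≤ cellHiCorner m k c' := by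
  intro h
  have hle := Subtype.coe_le_coe.2 (h j)
  have hm : (0 : ℝ) < (m : ℝ) + 1 := by positivity
  have hc'lt : ((c' j : ℕ)) < m := lt_of_lt_of_le hj (Nat.le_of_lt_succ (c j).2)
  simp only [cellLoCorner, cellHiCorner] at hle
  rw [coe_cellHi_of_lt hc'lt, coe_gridPt_eq_div (Nat.succ_pos m) (Nat.le_succ_of_le (Nat.le_of_lt_succ (c j).2))]
    at hle
  push_cast at hle
  have hjj : ((c' j : ℕ) : ℝ) + 1 ≤ ((c j : ℕ) : ℝ) := by exact_mod_cast hj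
  have hpos : 0 < 1 / (((m : ℝ) + 1) * ((k : ℝ) + 2)) := by positivity
  have h1 : (((c' j : ℕ) : ℝ) + 1) / ((m : ℝ) + 1) ≤ ((c j : ℕ) : ℝ) / ((m : ℝ) + 1) :=
    div_le_div_of_nonneg_right hjj hm.le
  linarith

/-! ### Affiliated ⟹ cell-FKG on every grid ⟹ box-TP₂ -/

/-- **An affiliated probability measure on `Q_d` is cell-FKG on every grid.** [this work] -/
theorem affiliated_isFKGMeasure_cubeCellWeight (μ : Measure (Fin d → I)) [IsProbabilityMeasure μ]
    (hμ : mIsAffiliated μ) (m : ℕ) : IsFKGMeasure (cubeCellWeight μ m) where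
  nonneg c := SahiCubeDensity.cubeCellWeight_nonneg μ c
  sum_eq_one := SahiCubeDensity.sum_cubeCellWeight μ
  mul_le_mul c c' := by
    have key : μ (cubeCell m ⁻¹' {c}) * μ (cubeCell m ⁻¹' {c'}) ≤
        μ (cubeCell m ⁻¹' {c ⊓ c'}) * μ (cubeCell m ⁻¹' {c ⊔ c'}) := by
      by_cases hcc' : c ≤ c'
      · rw [inf_eq_left.2 hcc', sup_eq_right.2 hcc']
      by_cases hc'c : c' ≤ c
      · rw [inf_eq_right.2 hc'c, sup_eq_left.2 hc'c, mul_comm]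
      -- incomparable cells: crosswise separated inner boxes
      obtain ⟨i, hi⟩ : ∃ i, c' i < c i := by
        by_contra h; simp only [not_exists, not_lt] at h; exact hcc' h
      obtain ⟨j, hj⟩ : ∃ j, c j < c' j := by
        by_contra h; simp only [not_exists, not_lt] at h; exact hc'c h
      rw [cubeCell_preimage_singleton_eq_iUnion, cubeCell_preimage_singleton_eq_iUnion,
        cubeCell_preimage_singleton_eq_iUnion, cubeCell_preimage_singleton_eq_iUnion]
      refine measure_mul_le_of_monotone_iUnion μ (monotone_cellBox c) (monotone_cellBox c')
        (monotone_cellBox _) (monotone_cellBox _) fun k => ?_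
      have h := hμ.icc_mul_icc_le_of_separated (not_cellLoCorner_le_cellHiCorner hi k)
        (not_cellLoCorner_le_cellHiCorner hj k)
      rwa [← cellLoCorner_inf, ← cellHiCorner_inf, ← cellLoCorner_sup, ← cellHiCorner_sup] at h
    simp only [cubeCellWeight, measureReal_def]
    rw [← ENNReal.toReal_mul, ← ENNReal.toReal_mul]
    exact ENNReal.toReal_mono (ENNReal.mul_ne_top (measure_ne_top _ _) (measure_ne_top _ _)) key

/-- **AFFILIATED ⟹ BOX-TP₂** for every probability measure on `Q_d`. [this work] -/
theorem isBoxTP2_of_mIsAffiliated (μ : Measure (Fin d → I)) [IsProbabilityMeasure μ] (hμ : mIsAffiliated μ) :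
    IsBoxTP2 μ :=
  isBoxTP2_of_isFKGMeasure_cubeCellWeight μ (affiliated_isFKGMeasure_cubeCellWeight μ hμ)

/-- **BOX-TP₂ ⟺ AFFILIATED** for every probability measure on the unit cube (no density). [this work] -/
theorem isBoxTP2_iff_mIsAffiliated (μ : Measure (Fin d → I)) [IsProbabilityMeasure μ] :
    IsBoxTP2 μ ↔ mIsAffiliated μ :=
  ⟨fun h => h.mIsAffiliated μ, isBoxTP2_of_mIsAffiliated μ⟩

/-- **SET-TP₂ ⟺ AFFILIATED** (Müller–Stoyan (ii) ⟺ (iii)) for every probability measure on the unit cube. [this work] -/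
theorem mIsSetTP2_iff_mIsAffiliated (μ : Measure (Fin d → I)) [IsProbabilityMeasure μ] :
    mIsSetTP2 μ ↔ mIsAffiliated μ := by
  rw [← isBoxTP2_iff_mIsSetTP2, isBoxTP2_iff_mIsAffiliated]

/-! ### The Hilbert cube -/

/-- **Marginals of an affiliated law are affiliated** (sublattices and upper sets pull back along the projection,
a lattice homomorphism). [folklore] -/
theorem affiliated_map_finRestrict {μ : Measure (ℕ → I)} (hμ : mIsAffiliated μ) (d : ℕ) :
    mIsAffiliated (μ.map (finRestrict d)) := by
  intro L hL hLsup hLinf A B hA hB hAup hBup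
  have hr := measurable_finRestrict (X := I) d
  rw [Measure.map_apply hr (hA.inter hL), Measure.map_apply hr (hB.inter hL),
    Measure.map_apply hr ((hA.inter hB).inter hL), Measure.map_apply hr hL, Set.preimage_inter, Set.preimage_inter,
    Set.preimage_inter, Set.preimage_inter]
  exact hμ (hr hL) (fun x hx y hy => hLsup hx hy) (fun x hx y hy => hLinf hx hy) (hr hA) (hr hB)
    (fun x y hxy hx => hAup (finRestrict_mono d hxy) hx) (fun x y hxy hx => hBup (finRestrict_mono d hxy) hx)

/-- **BOX-TP₂ ⟺ AFFILIATED on the Hilbert cube**, for every probability measure on `ℕ → [0,1]`. [this work] -/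
theorem isBoxTP2_iff_mIsAffiliated_hilbert (μ : Measure (ℕ → I)) [IsProbabilityMeasure μ] :
    IsBoxTP2 μ ↔ mIsAffiliated μ :=
  ⟨fun h => h.mIsAffiliated_hilbert μ, fun h => isBoxTP2_iff_forall_map_finRestrict_unitInterval.2 fun d =>
    isBoxTP2_of_mIsAffiliated _ (affiliated_map_finRestrict h d)⟩

/-- **SET-TP₂ ⟺ AFFILIATED on the Hilbert cube.** [this work] -/
theorem mIsSetTP2_iff_mIsAffiliated_hilbert (μ : Measure (ℕ → I)) [IsProbabilityMeasure μ] :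
    mIsSetTP2 μ ↔ mIsAffiliated μ := by
  rw [← isBoxTP2_iff_mIsSetTP2_hilbert, isBoxTP2_iff_mIsAffiliated_hilbert]

end Summit.CriticalPhenomena.PercolationContinuityZ3.Theorems.SahiBoxTP2
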